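import Literature.NumberTheory.EllipticCurves.TorsionFrobeniusProofs
import Literature.NumberTheory.EllipticCurves.FrobeniusEndomorphism
import Literature.NumberTheory.EllipticCurves.BSDQuadraticDescentTorsionOddPartProofs
import HarnessLib

/-!
# Frobenius at a good prime `ℓ ≠ p` on `E[p^K]`: fixed points = `Ẽ(𝔽_ℓ)[p^K]` (bridge B1, curve half)
# (cell `b2b-bsdres`, team n1011, ROUTE-1 item R1-23, bridge (B1) to R23_endshape's ℕ-currency;
# seat p18; file B1-frob-count)

HONEST FRAMING (verbatim for the cell): research route on the CONSTRUCTION-SHAPED class `X4` /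
N11; prove what is provable now; nothing booked; no mark / label moved.  TOOL theorems only — no
definition, no named fact; everything below is proved from the tree's reduction theory
(`exists_reduceTorsionHom`, Silverman VII.2.1 / VII.3.1(b)) exactly as in
`exists_frobenius_smul_eq_of_dvd_reductionPointCount_holds` (`TorsionFrobeniusProofs`).

## What is proved

* `natCard_torsionBy_pow_eq` — finite abelian `A` with `#A[p] ≤ p` and `p^K ∣ #A` has
  `#A[p^K] = p^K` (pure group theory: `#A[p^{j+1}] ≤ #A[p]·#A[p^j]` and `#A[p^∞] = p^{v_p(#A)}`).
* `exists_frobenius_natCard_fixed_eq` — for `E/ℚ` (globally minimal model `W`), primes `ℓ ≠ p`,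
  `ℓ` good, `v` the place at `ℓ`: there is an arithmetic Frobenius `σ₀` at a prime above `v` with
  `#{P ∈ E[p^j] : σ₀ P = P} = #Ẽ_v(k_v)[p^j]` for every `j` (reduction is injective on `p`-primary
  torsion, bijective on `E[p^j]` by counting, intertwines `σ₀` with the `ℓ`-power Frobenius, whose
  fixed points are the `k_v`-rational points, `smul_eq_self_iff_mem_range_toGeomPoints`).
* `exists_frobenius_kernel_data` — hence, for `ℓ` with `p^K ∣ #Ẽ(𝔽_ℓ)` (Kim's `𝒫_K`,
  `Kato.IsKolyvaginPrime.pow_dvd_reductionPointCount`) and the cyclicity flag `#Ẽ_v(k_v)[p] ≤ p`: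
  `#E[p^K]^{σ₀} = p^K` and `σ₀` moves a point of `E[p]` — the KERNEL data of
  `Unipotent.sq_eq_zero_and_exists_addOrderOf_eq_of_ker` / `nonempty_coker_addEquiv_zmod_of_ker`.

References: J. H. Silverman, *AEC* (2009) Prop. VII.3.1(b), VII.2.1, Cor. III.6.4(b), proof of
Thm. V.1.1 [SilvermanAEC2009]; C.-H. Kim, AJM 148 (2026) §1.2.2 [Kim2022StructureSelmer];
R. Sakamoto, Math. Ann. (2024) §2 (H.2) [Sakamoto2024].
-/

noncomputable section

open scoped Classical
open NumberField IsDedekindDomain IsDedekindDomain.HeightOneSpectrum Field WeierstrassCurve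
open Literature.NumberTheory.EllipticCurves Literature.NumberTheory.GaloisRepresentations

namespace Summit.BirchSwinnertonDyer.Rank1Residual.GaloisImage.FrobShape

/-! ## Group theory: `#A[p^K] = p^K` from `#A[p] ≤ p` and `p^K ∣ #A` -/

section Group

variable {A : Type*} [AddCommGroup A]

open AddSubgroup in
/-- `#A[p^{j+1}] ≤ #A[p] · #A[p^j]` (the map `a ↦ p•a` on `A[p^{j+1}]` lands in `A[p^j]` with
kernel in `A[p]`). [folklore] -/
theorem natCard_torsionBy_pow_succ_le [Finite A] (p j : ℕ) :
    Nat.card (torsionBy A (p ^ (j + 1) : ℕ)) ≤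
      Nat.card (torsionBy A (p : ℕ)) * Nat.card (torsionBy A (p ^ j : ℕ)) := by
  classical
  let m : torsionBy A (p ^ (j + 1) : ℕ) →+ A :=
    (DistribSMul.toAddMonoidHom A p).comp (torsionBy A (p ^ (j + 1) : ℕ)).subtype
  have hm : ∀ a, m a = p • (a : A) := fun a => rfl
  have hcard : Nat.card (torsionBy A (p ^ (j + 1) : ℕ)) = Nat.card m.ker * Nat.card m.range := by
    rw [m.ker.card_eq_card_quotient_mul_card_addSubgroup,
      Nat.card_congr (QuotientAddGroup.quotientKerEquivRange m).toEquiv, mul_comm]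
  have hker : Nat.card m.ker ≤ Nat.card (torsionBy A (p : ℕ)) := by
    refine Nat.card_le_card_of_injective (fun a => ⟨(a.1 : A), ?_⟩) ?_
    · have h := a.2
      rw [AddMonoidHom.mem_ker, hm] at h
      exact torsionBy.nsmul_iff.mpr h
    · intro a b h
      simp only [Subtype.mk.injEq] at h
      exact Subtype.ext (Subtype.ext h)
  have hrange : Nat.card m.range ≤ Nat.card (torsionBy A (p ^ j : ℕ)) := by
    refine Nat.card_le_card_of_injective (fun b => ⟨(b.1 : A), ?_⟩) ?_
    · obtain ⟨a, ha⟩ := b.2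
      rw [← ha, hm]
      refine torsionBy.nsmul_iff.mpr ?_
      rw [← mul_nsmul', ← pow_succ]
      exact torsionBy.nsmul_iff.mp a.2
    · intro a b h
      simp only [Subtype.mk.injEq] at h
      exact Subtype.ext h
  rw [hcard]
  exact Nat.mul_le_mul hker hrange

open AddSubgroup in
/-- `#A[p^{K+i}] ≤ p^i · #A[p^K]` when `#A[p] ≤ p`. [folklore] -/
theorem natCard_torsionBy_pow_add_le [Finite A] {p : ℕ} (h1 : Nat.card (torsionBy A (p : ℕ)) ≤ p)
    (K i : ℕ) :
    Nat.card (torsionBy A (p ^ (K + i) : ℕ)) ≤ p ^ i * Nat.card (torsionBy A (p ^ K : ℕ)) := by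
  induction i with
  | zero => simp
  | succ i ih =>
    calc Nat.card (torsionBy A (p ^ (K + (i + 1)) : ℕ))
        ≤ Nat.card (torsionBy A (p : ℕ)) * Nat.card (torsionBy A (p ^ (K + i) : ℕ)) := by
          rw [← add_assoc]; exact natCard_torsionBy_pow_succ_le p (K + i)
      _ ≤ p * (p ^ i * Nat.card (torsionBy A (p ^ K : ℕ))) := Nat.mul_le_mul h1 ih
      _ = p ^ (i + 1) * Nat.card (torsionBy A (p ^ K : ℕ)) := by ring

open AddSubgroup in
/-- **A finite abelian group with `#A[p] ≤ p` and `p^K ∣ #A` has `#A[p^K] = p^K`** (its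
`p`-primary part is cyclic of order `≥ p^K`). [folklore] -/
theorem natCard_torsionBy_pow_eq [Finite A] {p : ℕ} [hp : Fact p.Prime]
    (h1 : Nat.card (torsionBy A (p : ℕ)) ≤ p) {K : ℕ} (hdvd : p ^ K ∣ Nat.card A) :
    Nat.card (torsionBy A (p ^ K : ℕ)) = p ^ K := by
  classical
  have hup : ∀ j, Nat.card (torsionBy A (p ^ j : ℕ)) ≤ p ^ j := fun j => by
    have h := natCard_torsionBy_pow_add_le h1 0 j
    have h0 : Nat.card (torsionBy A (p ^ 0 : ℕ)) = 1 := by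
      rw [pow_zero, Nat.card_eq_one_iff_unique]
      refine ⟨⟨fun a b => Subtype.ext ?_⟩, ⟨0⟩⟩
      have ha := torsionBy.nsmul_iff.mp a.2
      have hb := torsionBy.nsmul_iff.mp b.2
      rw [one_nsmul] at ha hb
      rw [ha, hb]
    rw [zero_add, h0, mul_one] at h
    exact h
  set a := padicValNat p (Nat.card A) with ha
  have hA0 : Nat.card A ≠ 0 := Nat.card_pos.ne'
  have hKa : K ≤ a := (padicValNat_dvd_iff_le hA0).mp hdvd
  have hprim : Nat.card (AddCommGroup.primaryComponent A p) = p ^ a :=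
    natCard_primaryComponent_eq_pow_padicValNat p
  have hle : AddCommGroup.primaryComponent A p ≤ torsionBy A (p ^ a : ℕ) := by
    intro x hx
    refine torsionBy.nsmul_iff.mpr (addOrderOf_dvd_iff_nsmul_eq_zero.mp ?_)
    rw [← hprim]
    exact AddSubgroup.addOrderOf_dvd_natCard _ hx
  have hlow : p ^ a ≤ Nat.card (torsionBy A (p ^ a : ℕ)) :=
    calc p ^ a = Nat.card (AddCommGroup.primaryComponent A p) := hprim.symm
      _ ≤ Nat.card (torsionBy A (p ^ a : ℕ)) :=
        Nat.card_le_card_of_injective (AddSubgroup.inclusion hle) (AddSubgroup.inclusion_injective hle)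
  have hchain := natCard_torsionBy_pow_add_le h1 K (a - K)
  rw [Nat.add_sub_cancel' hKa] at hchain
  refine le_antisymm (hup K) ?_
  have hpos : 0 < p ^ (a - K) := pow_pos hp.out.pos _
  have : p ^ (a - K) * p ^ K ≤ p ^ (a - K) * Nat.card (torsionBy A (p ^ K : ℕ)) := by
    rw [← pow_add, Nat.sub_add_cancel hKa]
    exact hlow.trans hchain
  exact Nat.le_of_mul_le_mul_left this hpos

end Group

/-! ## Fixed points of a Frobenius on `E[p^j]` versus `Ẽ_v(k_v)[p^j]` -/

/-- **Fixed points of Frobenius on `E[p^j]` are the `p^j`-torsion of the reduction.**  For `E/ℚ`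
with globally minimal model `W`, primes `ℓ ≠ p` with `ℓ` good and `v` the place at `ℓ`, there is
an arithmetic Frobenius `σ₀ ∈ Γ_ℚ` at a prime above `v` such that for every `j`,
`#{P ∈ E[p^j] : σ₀ P = P} = #Ẽ_v(k_v)[p^j]`, `Ẽ_v = W.reductionAt v`.  Proof: the reduction map
`f : E[p^∞] → Ẽ_v(k̄_v)` (VII.2.1, injective by VII.3.1(b)) intertwines `σ₀` (a local Frobenius
restricted to `ℚ̄`) with the `ℓ`-power Frobenius `φ`, is onto `Ẽ_v[p^j]` by counting
(`#E[p^j] = p^{2j} = #Ẽ_v[p^j]`, III.6.4(b)), and the `φ`-fixed points of `Ẽ_v(k̄_v)` are the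
`k_v`-points (proof of Thm. V.1.1).
[cite: SilvermanAEC2009, Prop. VII.3.1(b) with Prop. VII.2.1, Cor. III.6.4(b), proof of Thm. V.1.1] -/
theorem exists_frobenius_natCard_fixed_eq (W : WeierstrassCurve ℚ) [W.IsElliptic]
    [W.IsGloballyMinimal] (p ℓ : ℕ) [Fact p.Prime] [Fact ℓ.Prime] (hℓp : ℓ ≠ p)
    (hgoodℓ : W.HasGoodReductionAtPrime ℓ) {v : HeightOneSpectrum (𝓞 ℚ)}
    (hv : (ℓ : 𝓞 ℚ) ∈ v.asIdeal) :
    ∃ (σ₀ : absoluteGaloisGroup ℚ) (𝔓₀ : Ideal (absIntegers (𝓞 ℚ) ℚ)),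
      𝔓₀ ∈ v.primesAbove ∧ IsArithFrobAt (𝓞 ℚ) σ₀ 𝔓₀ ∧
      ∀ j : ℕ, Nat.card {P : geomTorsion W (p ^ j : ℕ) // σ₀ • P = P} =
        Nat.card (AddSubgroup.torsionBy (W.reductionAt v).toAffine.Point (p ^ j : ℕ)) := by
  have hp : p.Prime := Fact.out
  have hℓ : ℓ.Prime := Fact.out
  -- from the rational prime `ℓ` to the place `v`
  have hvℓ : (Rat.HeightOneSpectrum.primesEquiv v : ℕ) = ℓ := primesEquiv_eq_of_natCast_mem hℓ hv
  have hgood : W.HasGoodReductionAt v :=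
    (hasGoodReductionAtPrime_primesEquiv_iff_holds W v ℓ hvℓ).mp hgoodℓ
  have hpv : (p : 𝓞 ℚ) ∉ v.asIdeal := fun h ↦
    hℓp (hvℓ.symm.trans (primesEquiv_eq_of_natCast_mem hp h))
  set k := IsLocalRing.ResidueField (v.adicCompletionIntegers ℚ) with hk
  set Wt : WeierstrassCurve k := W.reductionAt v with hWt
  haveI : Wt.IsElliptic := isElliptic_reductionAt hgood
  -- the reduction map on `p`-primary torsion along `ι`, for a local Frobenius `σ_v`
  obtain ⟨𝔐, h𝔐⟩ := v.localPrimesAbove_nonempty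
  let ι : AlgebraicClosure ℚ →ₐ[ℚ] AlgebraicClosure (v.adicCompletion ℚ) :=
    closureEmb (K := ℚ) (v.adicCompletion ℚ)
  obtain ⟨σL, hσL⟩ := v.exists_isArithFrobAt_localAbsIntegers h𝔐
  obtain ⟨φk, hφk⟩ := exists_frobenius_absoluteGaloisGroup k
  obtain ⟨f, hf, hfσ⟩ := exists_reduceTorsionHom hpv hgood h𝔐 ι hσL hφk
  set σ₀ : absoluteGaloisGroup ℚ := resGalOfEmb ι σL with hσ₀
  refine ⟨σ₀, v.primeBelow ι 𝔐, primeBelow_mem_primesAbove h𝔐, isArithFrobAt_resGalOfEmb h𝔐 ι hσL,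
    fun j => ?_⟩
  -- counting: `f` hits every `p^j`-torsion point of `Ẽ_v(k̄_v)`
  have hA : Nat.card (geomTorsion W (p ^ j : ℕ)) = (p ^ j) ^ 2 :=
    card_torsionPoints_eq_sq_holds W (AlgebraicClosure ℚ)
      (Nat.cast_ne_zero.mpr (pow_ne_zero j hp.ne_zero))
  have hpk : ((p ^ j : ℕ) : AlgebraicClosure k) ≠ 0 := by
    rw [← map_natCast (algebraMap k _), _root_.map_ne_zero, Nat.cast_pow]
    exact pow_ne_zero j (natCast_residueField_ne_zero hpv)
  have hB : Nat.card (geomTorsion Wt (p ^ j : ℕ)) = (p ^ j) ^ 2 :=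
    card_torsionPoints_eq_sq_holds Wt _ hpk
  haveI : Finite (geomTorsion Wt (p ^ j : ℕ)) :=
    Nat.finite_of_card_ne_zero (by rw [hB]; exact pow_ne_zero _ (pow_ne_zero _ hp.ne_zero))
  have hsurj : ∀ Q : geomPoints Wt, p ^ j • Q = 0 →
      ∃ P : geomPrimaryTorsion W p, p ^ j • P = 0 ∧ f P = Q := fun Q hQ =>
    exists_eq_of_injective_of_card_torsionBy_le f hf (hB.trans hA.symm).le hQ
  -- the comparison map `Ẽ_v(k_v)[p^j] → E[p^j]^{σ₀}`
  have key : ∀ Q₀ : AddSubgroup.torsionBy Wt.toAffine.Point (p ^ j : ℕ),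
      ∃ P : geomPrimaryTorsion W p, p ^ j • P = 0 ∧ f P = toGeomPoints Wt Q₀ := fun Q₀ =>
    hsurj _ (by rw [← map_nsmul, AddSubgroup.torsionBy.nsmul_iff.mp Q₀.2, map_zero])
  choose g hg hfg using key
  -- `g Q₀` is fixed by `σ₀`
  have hgfix : ∀ Q₀, σ₀ • g Q₀ = g Q₀ := fun Q₀ => hf (by
    rw [hfσ, hfg, smul_toGeomPoints])
  let G : AddSubgroup.torsionBy Wt.toAffine.Point (p ^ j : ℕ) →
      {P : geomTorsion W (p ^ j : ℕ) // σ₀ • P = P} := fun Q₀ =>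
    ⟨⟨(g Q₀ : geomPoints W), AddSubgroup.torsionBy.nsmul_iff.mpr (by
        have := congrArg Subtype.val (hg Q₀)
        simpa only [AddSubgroupClass.coe_nsmul, ZeroMemClass.coe_zero] using this)⟩,
      Subtype.ext (by
        have := congrArg Subtype.val (hgfix Q₀)
        rw [primaryComponent.coe_smul] at this
        rw [AddSubgroup.torsionBy.coe_smul]
        exact this)⟩
  have hGval : ∀ Q₀, ((G Q₀).1 : geomPoints W) = g Q₀ := fun Q₀ => rfl
  refine (Nat.card_eq_of_bijective G ⟨?_, ?_⟩).symm
  · -- injective: `f ∘ g = toGeomPoints` is injective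
    intro Q₀ Q₁ h
    have h1 : (g Q₀ : geomPoints W) = g Q₁ := by
      rw [← hGval, ← hGval, h]
    have h2 : f (g Q₀) = f (g Q₁) := by rw [Subtype.ext h1]
    rw [hfg, hfg] at h2
    exact Subtype.ext (toGeomPoints_injective Wt h2)
  · -- surjective: a `σ₀`-fixed `P ∈ E[p^j]` reduces to a `φ`-fixed, hence `k_v`-rational, point
    rintro ⟨P, hP⟩
    let P' : geomPrimaryTorsion W p := ⟨(P : geomPoints W), j, by
      have := AddSubgroup.torsionBy.nsmul_iff.mp P.2
      exact this⟩
    have hP'fix : σ₀ • P' = P' := Subtype.ext (by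
      rw [primaryComponent.coe_smul]
      have := congrArg Subtype.val hP
      rwa [AddSubgroup.torsionBy.coe_smul] at this)
    have hQfix : φk • f P' = f P' := by rw [← hfσ, hP'fix]
    obtain ⟨Q₀, hQ₀⟩ := (smul_eq_self_iff_mem_range_toGeomPoints hφk (f P')).mp hQfix
    have hQ₀t : p ^ j • Q₀ = 0 := by
      apply toGeomPoints_injective Wt
      rw [map_nsmul, hQ₀, ← map_nsmul, map_zero]
      have : p ^ j • P' = 0 := Subtype.ext (by
        rw [AddSubgroupClass.coe_nsmul, ZeroMemClass.coe_zero]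
        exact AddSubgroup.torsionBy.nsmul_iff.mp P.2)
      rw [this, map_zero]
    refine ⟨⟨Q₀, AddSubgroup.torsionBy.nsmul_iff.mpr hQ₀t⟩, ?_⟩
    have hgP : g ⟨Q₀, AddSubgroup.torsionBy.nsmul_iff.mpr hQ₀t⟩ = P' :=
      hf (by rw [hfg]; exact hQ₀)
    apply Subtype.ext
    apply Subtype.ext
    rw [hGval, hgP]

/-- **Kernel data of a Frobenius at a Kolyvagin prime.**  `E/ℚ` with globally minimal model
`W`, primes `ℓ ≠ p`, `ℓ` good, `v` the place at `ℓ`, `K ≥ 1`, the CYCLICITY FLAG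
`#Ẽ_v(k_v)[p] ≤ p` and `p^K ∣ #Ẽ(𝔽_ℓ)` (Kim's `ℓ ∈ 𝒫_K`: `a_ℓ ≡ ℓ + 1 (mod p^K)`,
`Kato.IsKolyvaginPrime.pow_dvd_reductionPointCount`): there is an arithmetic Frobenius `σ₀` at a
prime above `v` with EXACTLY `p^K` fixed points on `E[p^K]` and moving some point of
`E[p] = p^{K−1}E[p^K]` — the kernel currency of `Unipotent.nonempty_coker_addEquiv_zmod_of_ker`
((H.2) for `σ₀`). [cite: Kim2022StructureSelmer, §1.2.2] [cite: Sakamoto2024, §2 (H.2) (p. 921)]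
[cite: SilvermanAEC2009, Prop. VII.3.1(b) with Cor. III.6.4(b)] -/
theorem exists_frobenius_kernel_data (W : WeierstrassCurve ℚ) [W.IsElliptic]
    [W.IsGloballyMinimal] (p ℓ : ℕ) [Fact p.Prime] [Fact ℓ.Prime] (hℓp : ℓ ≠ p)
    (hgoodℓ : W.HasGoodReductionAtPrime ℓ) {v : HeightOneSpectrum (𝓞 ℚ)}
    (hv : (ℓ : 𝓞 ℚ) ∈ v.asIdeal) {K : ℕ} (hK : 0 < K)
    (hflag : Nat.card (AddSubgroup.torsionBy (W.reductionAt v).toAffine.Point (p : ℕ)) ≤ p)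
    (hdvd : p ^ K ∣ W.reductionPointCount ℓ) :
    ∃ (σ₀ : absoluteGaloisGroup ℚ) (𝔓₀ : Ideal (absIntegers (𝓞 ℚ) ℚ)),
      𝔓₀ ∈ v.primesAbove ∧ IsArithFrobAt (𝓞 ℚ) σ₀ 𝔓₀ ∧
      Nat.card {P : geomTorsion W (p ^ K : ℕ) // σ₀ • P = P} = p ^ K ∧
      ∃ R : geomTorsion W (p ^ K : ℕ), p ^ (K - 1) • (σ₀ • R - R) ≠ 0 := by
  have hp : p.Prime := Fact.out
  have hℓ : ℓ.Prime := Fact.out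
  obtain ⟨σ₀, 𝔓₀, h𝔓₀, hσ₀, hcount⟩ := exists_frobenius_natCard_fixed_eq W p ℓ hℓp hgoodℓ hv
  have hvℓ : (Rat.HeightOneSpectrum.primesEquiv v : ℕ) = ℓ := primesEquiv_eq_of_natCast_mem hℓ hv
  have hcardWt : Nat.card (W.reductionAt v).toAffine.Point = W.reductionPointCount ℓ := by
    rw [← hvℓ]
    exact natCard_point_reduction_minimal_baseChange v W
  haveI : Finite (W.reductionAt v).toAffine.Point :=
    Nat.finite_of_card_ne_zero (by rw [hcardWt]; exact (W.reductionPointCount_pos ℓ).ne')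
  refine ⟨σ₀, 𝔓₀, h𝔓₀, hσ₀, ?_, ?_⟩
  · -- `#E[p^K]^{σ₀} = #Ẽ_v(k_v)[p^K] = p^K`
    rw [hcount K]
    exact natCard_torsionBy_pow_eq hflag (by rw [hcardWt]; exact hdvd)
  · -- `σ₀` moves a point of `E[p]`, and `E[p] = p^{K-1} E[p^K]`
    have hc1 := hcount 1
    rw [pow_one] at hc1
    have h1 : Nat.card {P : geomTorsion W (p : ℕ) // σ₀ • P = P} ≤ p := by rw [hc1]; exact hflag
    have hE : Nat.card (geomTorsion W (p : ℕ)) = p ^ 2 :=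
      card_torsionPoints_eq_sq_holds W (AlgebraicClosure ℚ) (Nat.cast_ne_zero.mpr hp.ne_zero)
    rcases em (∃ R : geomTorsion W (p ^ K : ℕ), p ^ (K - 1) • (σ₀ • R - R) ≠ 0) with h | h
    · exact h
    exfalso
    have hall : ∀ R : geomTorsion W (p ^ K : ℕ), p ^ (K - 1) • (σ₀ • R - R) = 0 := fun R => by
      rcases em (p ^ (K - 1) • (σ₀ • R - R) = 0) with h0 | h0
      · exact h0
      · exact absurd ⟨R, h0⟩ h
    have hpK : (p : ℤ) ^ K = (p : ℤ) * (p : ℤ) ^ (K - 1) := by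
      rw [← pow_succ', Nat.sub_add_cancel hK]
    -- every `P ∈ E[p]` is fixed
    have hfix : ∀ P : geomTorsion W (p : ℕ), σ₀ • P = P := by
      intro P
      have hk : ((p : ℤ) ^ (K - 1)) ≠ 0 := pow_ne_zero _ (Int.natCast_ne_zero.mpr hp.ne_zero)
      obtain ⟨R₀, hR₀⟩ : ∃ R₀ : geomPoints W, (p : ℤ) ^ (K - 1) • R₀ = (P : geomPoints W) :=
        (W.baseChange (AlgebraicClosure ℚ)).zsmul_surjective_of_isAlgClosed hk (P : geomPoints W)
      have hR₀' : p ^ (K - 1) • R₀ = (P : geomPoints W) := by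
        rw [← natCast_zsmul, Nat.cast_pow]; exact hR₀
      have hPp : p • (P : geomPoints W) = 0 := AddSubgroup.torsionBy.nsmul_iff.mp P.2
      have hPpZ : (p : ℤ) • (P : geomPoints W) = 0 := by rw [natCast_zsmul]; exact hPp
      have hRmem : R₀ ∈ geomTorsion W (p ^ K : ℕ) := by
        refine (mem_geomTorsion_iff W _ _).mpr ?_
        rw [Nat.cast_pow, hpK, mul_zsmul, hR₀, hPpZ]
      have h0 := congrArg Subtype.val (hall ⟨R₀, hRmem⟩)
      rw [AddSubgroupClass.coe_nsmul, ZeroMemClass.coe_zero, AddSubgroupClass.coe_sub,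
        AddSubgroup.torsionBy.coe_smul, nsmul_sub, sub_eq_zero] at h0
      change p ^ (K - 1) • σ₀ • R₀ = p ^ (K - 1) • R₀ at h0
      rw [smul_comm, hR₀'] at h0
      exact Subtype.ext (by rw [AddSubgroup.torsionBy.coe_smul]; exact h0)
    -- so `#E[p]^{σ₀} = #E[p] = p²`, contradicting `≤ p`
    have hcardfix : Nat.card {P : geomTorsion W (p : ℕ) // σ₀ • P = P} =
        Nat.card (geomTorsion W (p : ℕ)) :=
      Nat.card_congr (Equiv.subtypeUnivEquiv hfix)
    rw [hcardfix, hE] at h1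
    have : p < p ^ 2 := by
      have := hp.one_lt
      nlinarith
    omega

end Summit.BirchSwinnertonDyer.Rank1Residual.GaloisImage.FrobShape

end
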